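import Mathlib
import HarnessLib
import Summits.HubbardSuperconductivity.HubbardSuperconductivity.Theorems.KLProgrammeKLRegimeVolumeLimitTwoPointFourierGlue
import Summits.HubbardSuperconductivity.HubbardSuperconductivity.Theorems.KLProgrammeThermalGreenMatsubaraWordAllU

/-!
# Child `KLRegimeVolumeLimitV12` (stmt-HubbardSuperconductivity-19858), stub `stub_vl_bound` — FINAL REDUCTION: the Grassmann-side inputs
# (P6) and (P2) of `stub_vl_bound_of_pointwise_limits` are DISCHARGED by k3c4-p2's all-`U` pair-word Matsubara machine; the registered stub
# now follows from ONE `L`-uniform Hamiltonian bound (seat hubbard-kl-k3c5-p3, technique «OS-positivity-free direct assembly»)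

`…VolumeLimitTwoPointFourierGlue.stub_vl_bound_of_pointwise_limits` closes the registered stub from (P6) pointwise word six-point limits + sup
bound, (P2) pointwise τ-two-point limits + sup bound, and (B2) one `L`-uniform bound.  Both (P6) and (P2) are instances of k3c4-p2's
`tendsto_gaussExpect_word_mul_grassmannExp_allU` / `exists_uniform_bound_gaussExpect_word_allU` (`…ThermalGreenMatsubaraWordAllU`: the t2 all-`U`
machine for an ARBITRARY pair-word, constants uniform in the external times): the six-point word is the pair-word with two points `(z,u), (0,0)`
and three pairs `(ψ⁺_{(z,u)↑},ψ⁻_{(0,0)↑}), (ψ⁺_{(z,u)↓},ψ⁻_{(z,u)↓}), (ψ⁺_{(0,0)↓},ψ⁻_{(0,0)↓})`, the two-point word the pair-word with one pair.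
RESULT `stub_vl_bound_of_hamiltonianBound`: for EVERY coupling, the registered `stub_vl_bound` text holds as soon as, for every `β > 0`, `U`, `μ`,
`L ≥ 3`, Matsubara integer `n` and torus momentum `p`,
  `‖(Iinf n p / D∞ + ĝ)/ĝ²‖ ≤ BH β U μ`,   `Iinf n p = ∫₀^β Σ_x e^{−iω_n s} conj χ_p(x) · Pinf x s ds`,
with `Pinf x s := limUnder atTop (M ↦ ∫dμ_{C_M}ψ⁺_{(x,s)↑}ψ⁻_{(0,0)↑}e^{−V_M})` (the all-`U` limit, which EXISTS by the machine), `D∞ = e^{−βUL²/4}Z_U/Z₀`,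
`ĝ = 1/(−iω_n + ξ_p)` — i.e. exactly k3c5-p2's `‖(ĝ − 𝒢_L)(−ik₀+ξ)²‖ ≤ |U|(2+β|U|)` (`…ThermalGreenHubbardTorusExact`) once `Pinf x s / D∞` is identified
with the Hamiltonian τ-two-point function ((H1), k3c5-p1; (P3), k3c5-p2).  Everything is proved; no definition.
-/

noncomputable section

namespace Summit.HubbardSuperconductivity.HubbardSuperconductivity.Theorems.TwoPointAssembly

set_option linter.dupNamespace false -- summit = problem name (single-conjunct summit), D-0017

open Finset Filter Topology MeasureTheory intervalIntegral Literature.MathematicalPhysics.QuantumLattice Literature.Probability.LatticeModels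
  GrassmannAlgebra
open Summit.HubbardSuperconductivity.HubbardSuperconductivity.Theorems.KLRegimeSplit
open Summit.HubbardSuperconductivity.HubbardSuperconductivity.Theorems.KLProgrammeLegKernels
open scoped ComplexConjugate ComplexOrder

variable {L M : ℕ} [NeZero L]

/-! ## §1 The six-point and two-point words as pair-words of the machine -/

omit [NeZero L] in
/-- Leg enumerations of the six-point pair-word are injective. -/
theorem sixPair_injective :
    Function.Injective (![((0 : Fin 2), (0 : Fin 2)), (0, 1), (1, 1)] : Fin 3 → Fin 2 × Fin 2) ∧
      Function.Injective (![((1 : Fin 2), (0 : Fin 2)), (0, 1), (1, 1)] : Fin 3 → Fin 2 × Fin 2) := by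
  constructor <;> decide

/-- **The six-point word IS the machine's pair-word** (points `![z, 0]`, times `![u, 0]`, `E` moved to the right). -/
theorem boltzmann_mul_sixPointWord_eq_word (β U : ℝ) (z : TorusSite 2 L) (u : ℝ) :
    grassmannExp (-(hubbardInteraction L M β U)) * sixPointWord L M β 0 1 z u =
      (List.ofFn fun l : Fin 3 =>
          positionField L M β 0 ((![((0 : Fin 2), (0 : Fin 2)), (0, 1), (1, 1)] : Fin 3 → Fin 2 × Fin 2) l).2
              ((![z, 0] : Fin 2 → TorusSite 2 L) ((![((0 : Fin 2), (0 : Fin 2)), (0, 1), (1, 1)] : Fin 3 → Fin 2 × Fin 2) l).1)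
              ((![u, 0] : Fin 2 → ℝ) ((![((0 : Fin 2), (0 : Fin 2)), (0, 1), (1, 1)] : Fin 3 → Fin 2 × Fin 2) l).1) *
            positionField L M β 1 ((![((1 : Fin 2), (0 : Fin 2)), (0, 1), (1, 1)] : Fin 3 → Fin 2 × Fin 2) l).2
              ((![z, 0] : Fin 2 → TorusSite 2 L) ((![((1 : Fin 2), (0 : Fin 2)), (0, 1), (1, 1)] : Fin 3 → Fin 2 × Fin 2) l).1)
              ((![u, 0] : Fin 2 → ℝ) ((![((1 : Fin 2), (0 : Fin 2)), (0, 1), (1, 1)] : Fin 3 → Fin 2 × Fin 2) l).1)).prod *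
        grassmannExp (-(hubbardInteraction L M β U)) := by
  rw [boltzmann_comm, sixPointWord]
  simp [List.ofFn_succ, mul_assoc]

/-- **The two-point word IS the machine's pair-word** (points `![x, 0]`, times `![s, 0]`, one pair). -/
theorem twoPointWord_eq_word (β U : ℝ) (σ : Fin 2) (x : TorusSite 2 L) (s : ℝ) :
    positionField L M β 0 σ x s * positionField L M β 1 σ 0 0 * grassmannExp (-(hubbardInteraction L M β U)) =
      (List.ofFn fun l : Fin 1 =>
          positionField L M β 0 ((![((0 : Fin 2), σ)] : Fin 1 → Fin 2 × Fin 2) l).2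
              ((![x, 0] : Fin 2 → TorusSite 2 L) ((![((0 : Fin 2), σ)] : Fin 1 → Fin 2 × Fin 2) l).1)
              ((![s, 0] : Fin 2 → ℝ) ((![((0 : Fin 2), σ)] : Fin 1 → Fin 2 × Fin 2) l).1) *
            positionField L M β 1 ((![((1 : Fin 2), σ)] : Fin 1 → Fin 2 × Fin 2) l).2
              ((![x, 0] : Fin 2 → TorusSite 2 L) ((![((1 : Fin 2), σ)] : Fin 1 → Fin 2 × Fin 2) l).1)
              ((![s, 0] : Fin 2 → ℝ) ((![((1 : Fin 2), σ)] : Fin 1 → Fin 2 × Fin 2) l).1)).prod *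
        grassmannExp (-(hubbardInteraction L M β U)) := by
  simp [List.ofFn_succ]

omit [NeZero L] in
/-- The time curve `![u, 0]` stays in `[0, β)` for `u ∈ [0, β)` (`β > 0`). -/
theorem timePair_mem_Ico {β : ℝ} (hβ : 0 < β) {u : ℝ} (hu : u ∈ Set.Ico (0 : ℝ) β) : ∀ p : Fin 2, (![u, 0] : Fin 2 → ℝ) p ∈ Set.Ico (0 : ℝ) β := by
  intro p; fin_cases p
  · simpa using hu
  · simpa using hβ

omit [NeZero L] in
/-- The time curve `![u, 0]` stays in `[0, β]` for `u ∈ [0, β]` (`β > 0`). -/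
theorem timePair_mem_Icc {β : ℝ} (hβ : 0 < β) {u : ℝ} (hu : u ∈ Set.Icc (0 : ℝ) β) : ∀ p : Fin 2, (![u, 0] : Fin 2 → ℝ) p ∈ Set.Icc (0 : ℝ) β := by
  intro p; fin_cases p
  · simpa using hu
  · simpa using hβ.le

/-! ## §2 (P6) and (P2) discharged -/

/-- **(P6) holds for every coupling**: pointwise-in-`u ∈ [0,β)` limits and an `M`-eventual sup bound on `[0,β]` (uniform in the torus site) of the
word six-point numerator `∫dμ_{C_M} e^{−V}·sixPointWord L M β 0 1 z u`. -/
theorem sixPoint_pointwise_and_bound {β : ℝ} (hβ : 0 < β) (U μ : ℝ) :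
    ∃ (Sinf : TorusSite 2 L → ℝ → ℂ) (C : ℝ),
      (∀ z : TorusSite 2 L, ∀ u ∈ Set.Ico (0 : ℝ) β, Tendsto (fun M : ℕ =>
        gaussExpect ℂ (hubbardCovariance L M β μ 0) (grassmannExp (-(hubbardInteraction L M β U)) * sixPointWord L M β 0 1 z u))
          atTop (𝓝 (Sinf z u))) ∧
      (∀ᶠ M : ℕ in atTop, ∀ (z : TorusSite 2 L), ∀ u ∈ Set.Icc (0 : ℝ) β,
        ‖gaussExpect ℂ (hubbardCovariance L M β μ 0) (grassmannExp (-(hubbardInteraction L M β U)) * sixPointWord L M β 0 1 z u)‖ ≤ C) := by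
  obtain ⟨hPe, hQe⟩ := sixPair_injective
  -- pointwise limits: the `limUnder` of the convergent sequence
  refine ⟨fun z u => limUnder atTop (fun M : ℕ =>
      gaussExpect ℂ (hubbardCovariance L M β μ 0) (grassmannExp (-(hubbardInteraction L M β U)) * sixPointWord L M β 0 1 z u)), ?_⟩
  -- uniform bound: per site from the machine, then the max over the finite torus
  have hb : ∀ z : TorusSite 2 L, ∃ C : ℝ, 0 ≤ C ∧ ∃ M₀ : ℕ, ∀ M, M₀ ≤ M → ∀ u ∈ Set.Icc (0 : ℝ) β,
      ‖gaussExpect ℂ (hubbardCovariance L M β μ 0) (grassmannExp (-(hubbardInteraction L M β U)) * sixPointWord L M β 0 1 z u)‖ ≤ C := by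
    intro z
    obtain ⟨C, hC0, M₀, hM₀⟩ := MatsubaraAllU.exists_uniform_bound_gaussExpect_word_allU (L := L) hβ μ U (![z, 0]) _ _ hPe hQe
    refine ⟨C, hC0, M₀, fun M hM u hu => ?_⟩
    rw [boltzmann_mul_sixPointWord_eq_word]
    exact hM₀ M hM _ (timePair_mem_Icc hβ hu)
  choose Cz hCz0 M₀ hM₀ using hb
  refine ⟨∑ z : TorusSite 2 L, Cz z, fun z u hu => ?_, ?_⟩
  · have h := MatsubaraAllU.tendsto_gaussExpect_word_mul_grassmannExp_allU (L := L) hβ μ U (![z, 0]) (timePair_mem_Ico hβ hu) _ _ hPe hQe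
    exact tendsto_nhds_limUnder ⟨_, h.congr fun M => congrArg _ (boltzmann_mul_sixPointWord_eq_word (M := M) β U z u).symm⟩
  · filter_upwards [Filter.eventually_all.2 fun z => eventually_ge_atTop (M₀ z)] with M hM z u hu
    exact (hM₀ z M (hM z) u hu).trans (Finset.single_le_sum (fun z _ => hCz0 z) (Finset.mem_univ z))

/-- **(P2) holds for every coupling**: pointwise-in-`s ∈ [0,β)` limits and an `M`-eventual sup bound on `[0,β]` (uniform in the site) of the
τ-resolved position two-point numerator `∫dμ_{C_M} ψ⁺_{(x,s)σ}ψ⁻_{(0,0)σ}e^{−V}`. -/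
theorem twoPoint_pointwise_and_bound {β : ℝ} (hβ : 0 < β) (U μ : ℝ) (σ : Fin 2) :
    ∃ C₂ : ℝ,
      (∀ x : TorusSite 2 L, ∀ s ∈ Set.Ico (0 : ℝ) β, Tendsto (fun M : ℕ =>
        gaussExpect ℂ (hubbardCovariance L M β μ 0)
          (positionField L M β 0 σ x s * positionField L M β 1 σ 0 0 * grassmannExp (-(hubbardInteraction L M β U))))
          atTop (𝓝 (limUnder atTop (fun M : ℕ => gaussExpect ℂ (hubbardCovariance L M β μ 0)
            (positionField L M β 0 σ x s * positionField L M β 1 σ 0 0 * grassmannExp (-(hubbardInteraction L M β U))))))) ∧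
      (∀ᶠ M : ℕ in atTop, ∀ (x : TorusSite 2 L), ∀ s ∈ Set.Icc (0 : ℝ) β,
        ‖gaussExpect ℂ (hubbardCovariance L M β μ 0)
          (positionField L M β 0 σ x s * positionField L M β 1 σ 0 0 * grassmannExp (-(hubbardInteraction L M β U)))‖ ≤ C₂) := by
  have hPe : Function.Injective (![((0 : Fin 2), σ)] : Fin 1 → Fin 2 × Fin 2) := Function.injective_of_subsingleton _
  have hQe : Function.Injective (![((1 : Fin 2), σ)] : Fin 1 → Fin 2 × Fin 2) := Function.injective_of_subsingleton _
  have hb : ∀ x : TorusSite 2 L, ∃ C : ℝ, 0 ≤ C ∧ ∃ M₀ : ℕ, ∀ M, M₀ ≤ M → ∀ s ∈ Set.Icc (0 : ℝ) β,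
      ‖gaussExpect ℂ (hubbardCovariance L M β μ 0)
        (positionField L M β 0 σ x s * positionField L M β 1 σ 0 0 * grassmannExp (-(hubbardInteraction L M β U)))‖ ≤ C := by
    intro x
    obtain ⟨C, hC0, M₀, hM₀⟩ := MatsubaraAllU.exists_uniform_bound_gaussExpect_word_allU (L := L) hβ μ U (![x, 0])
      (![((0 : Fin 2), σ)]) (![((1 : Fin 2), σ)]) hPe hQe
    refine ⟨C, hC0, M₀, fun M hM s hs => ?_⟩
    rw [twoPointWord_eq_word]
    exact hM₀ M hM _ (timePair_mem_Icc hβ hs)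
  choose Cx hCx0 M₀ hM₀ using hb
  refine ⟨∑ x : TorusSite 2 L, Cx x, fun x s hs => ?_, ?_⟩
  · have h := MatsubaraAllU.tendsto_gaussExpect_word_mul_grassmannExp_allU (L := L) hβ μ U (![x, 0]) (timePair_mem_Ico hβ hs)
      (![((0 : Fin 2), σ)]) (![((1 : Fin 2), σ)]) hPe hQe
    exact tendsto_nhds_limUnder ⟨_, h.congr fun M => congrArg _ (twoPointWord_eq_word (M := M) β U σ x s).symm⟩
  · filter_upwards [Filter.eventually_all.2 fun x => eventually_ge_atTop (M₀ x)] with M hM x s hs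
    exact (hM₀ x M (hM x) s hs).trans (Finset.single_le_sum (fun x _ => hCx0 x) (Finset.mem_univ x))

/-! ## §3 The registered stub from ONE Hamiltonian bound -/

/-- **`stub_vl_bound` FROM ONE `L`-UNIFORM BOUND, for every coupling.**  Let `Pinf x s := lim_M ∫dμ_{C_M}ψ⁺_{(x,s)↑}ψ⁻_{(0,0)↑}e^{−V_M}` (the all-`U`
limit; `limUnder`), `D∞ := e^{−βUL²/4}Z_U(μ+U/2)/Z₀(μ)`, `Iinf n p := ∫₀^β Σ_x e^{−iω_n s} conj χ_p(x) Pinf x s ds`, `ĝ := 1/(−iω_n + ξ_p)`.  IF for every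
`β > 0`, `U`, `μ`, `L ≥ 3`, `n : ℤ`, `p`: `‖(Iinf n p / D∞ + ĝ)/ĝ²‖ ≤ BH β U μ`, THEN the registered `stub_vl_bound` text holds verbatim. -/
theorem stub_vl_bound_of_hamiltonianBound (BH : ℝ → ℝ → ℝ → ℝ)
    (hB : ∀ β : ℝ, 0 < β → ∀ (U μ : ℝ) (L : ℕ) [NeZero L], 3 ≤ L → ∀ (n : ℤ) (p : TorusSite 2 L),
      ‖((∫ s in (0 : ℝ)..β, ∑ x : TorusSite 2 L,
          Complex.exp (-(((Real.pi * (2 * (n : ℝ) + 1) / β * s : ℝ) : ℂ) * Complex.I)) * conj (torusChar p x) *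
            limUnder atTop (fun M : ℕ => gaussExpect ℂ (hubbardCovariance L M β μ 0)
              (positionField L M β 0 0 x s * positionField L M β 1 0 0 0 * grassmannExp (-(hubbardInteraction L M β U))))) /
          (((Real.exp (-(β * U / 4 * (L : ℝ) ^ 2)) : ℝ) : ℂ) * Matrix.partitionFn β (hubbardTorusWith 2 L 1 U (μ + U / 2)) /
            Matrix.partitionFn β (hubbardTorusWith 2 L 1 0 μ)) +
        1 / (-Complex.I * ((Real.pi * (2 * (n : ℝ) + 1) / β : ℝ) : ℂ) + (nambuXiCT L μ 0 p : ℂ))) /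
        (1 / (-Complex.I * ((Real.pi * (2 * (n : ℝ) + 1) / β : ℝ) : ℂ) + (nambuXiCT L μ 0 p : ℂ))) ^ 2‖ ≤ BH β U μ) :
    ∀ (G : GeoConsts) (P : SplitConsts) (Q : EngConsts) (R : RenConsts), G.WF → P.WF → Q.WF → R.WF →
      ∃ c₅ : ℝ, 0 < c₅ ∧ ∀ c : ℝ, 0 < c → c ≤ c₅ → ∃ U₀ : ℝ, 0 < U₀ ∧
        ∀ μ ∈ klWindowC, ∀ U : ℝ, 0 < U → U ≤ U₀ → ∀ β : ℝ, klBetaMin ≤ β → β ≤ Real.exp (c / U ^ 2) →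
          ∀ K : TrigPolyC4v, klPredsV12.frameOK R U (nScales β) μ K →
            ∀ (Lstar : ℕ) (Mstar : ℕ → ℕ), TowerP klPredsV12 G P Q R β U μ K Lstar Mstar →
              ∃ B : ℝ, ∃ L₀ : ℕ, ∃ Mth : ℕ → ℕ, ∀ (L : ℕ) [NeZero L], L₀ ≤ L → ∀ (M : ℕ) [NeZero M], Mth L ≤ M →
                ∀ (k : FreqMomentum L M) (σ : Fin 2), ‖klSelfEnergy L M β U μ K klE0 (nScales β + 1) k σ‖ ≤ B := by
  refine stub_vl_bound_of_pointwise_limits BH fun β hβ U μ L _ hL => ⟨sixPoint_pointwise_and_bound hβ U μ, ?_⟩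
  obtain ⟨C₂, hpt, hbd⟩ := twoPoint_pointwise_and_bound (L := L) hβ U μ 0
  exact ⟨_, C₂, hpt, hbd, hB β hβ U μ L hL⟩

end Summit.HubbardSuperconductivity.HubbardSuperconductivity.Theorems.TwoPointAssembly

end
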